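import Mathlib
import Summits.Ventures.PercRepro2.A3CutFMo

/-!
# (FM) at every vertex of a part containing at most the mark `o`, hanging at `b` or at a root
(blind cell PercRepro2, night-1 g32; proofs/NIGHT1-G32.md §6)

`FMfun_cut_oA` (the cut-vertex closure of (FM) with `o` on the part's side) and (FM) at the marks
`b`, `a₁`, `a₂` (A3PendantFreeMarks, A3PendantFreeRoot) give **`FM_pendantPartO_mark`**: (FM) holds at
every vertex `v` of a part that contains no mark other than `o` and hangs at a cut vertex that is `b`,
`a₁` or `a₂`.  Standard axioms.
-/

namespace Summit.Ventures.PercRepro2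

open UnionCluster CovForm CutV

namespace CovForm

namespace A3Fibre

section OMark

variable {V : Type*} {E : Type*} [Fintype V] [DecidableEq V] [Fintype E] [DecidableEq E]
  {R : Type*} [Field R] [LinearOrder R] [IsStrictOrderedRing R] {ends : E → Sym2 V} {x : V}
  {VA VB : Finset V} {EA EB : Set E} [DecidablePred (· ∈ EA)] [DecidablePred (· ∈ EB)] {p : E → R}
  {o a₁ a₂ b v : V}

/-- **(FM) at every vertex of a part containing at most `o`, hanging at `b` or at a root.** -/
theorem FM_pendantPartO_mark (hp : IsProbVec p) (h : IsCut ends x ↑VA ↑VB EA EB)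
    (hx : x = b ∨ x = a₁ ∨ x = a₂) (ho : o ∈ VA) (hv : v ∈ VA) (h1 : a₁ ∈ insert x VB)
    (h2 : a₂ ∈ insert x VB) (hb : b ∈ insert x VB) : 0 ≤ FMfun p ends o a₁ a₂ v b := by
  refine FM_cut_oA_of hp h ho hv h1 h2 hb ?_
  rcases hx with rfl | rfl | rfl
  · exact FM_self_b hp ends _ _ _ _
  · exact FM_self_root hp ends _ _ _ _
  · exact FM_self_root₂ hp ends _ _ _ _

end OMark

end A3Fibre

end CovForm

end Summit.Ventures.PercRepro2
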